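import Mathlib
import HarnessLib
import HarnessLib.Audit
import Summits.BirchSwinnertonDyer.Statement
import HarnessLib.Audit.Check
import Literature.NumberTheory.EllipticCurves.Selmer
import Literature.NumberTheory.EllipticCurves.Sha
import Literature.NumberTheory.EllipticCurves.QuadraticTwist
import Literature.NumberTheory.EllipticCurves.GlobalMinimalModel
import Literature.NumberTheory.EllipticCurves.GaloisAction
import Literature.NumberTheory.EllipticCurves.Tamagawa
import Literature.NumberTheory.EllipticCurves.OrdinaryPrimes
import Literature.NumberTheory.DiophantineGeometry.Conductor
import Literature.NumberTheory.EllipticCurves.SelmerCorankHolds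
import Literature.NumberTheory.EllipticCurves.GlobalMinimalModelProofs
import Literature.NumberTheory.EllipticCurves.OrdinaryPrimesProofs
import Literature.NumberTheory.EllipticCurves.MinimalModelReduction
import Literature.NumberTheory.EllipticCurves.VariableChangePoints
import Literature.NumberTheory.DiophantineGeometry.LocalReductionProofs
import Literature.NumberTheory.DiophantineGeometry.MinimalModelUniquenessProofs
import Summits.BirchSwinnertonDyer.BirchSwinnertonDyer.Theorems.SelmerRankAssembly
import Summits.BirchSwinnertonDyer.BirchSwinnertonDyer.Theorems.SelmerRankShaCorank
import HarnessLib.Audit.Status.Attr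

/-!
Route: VerticalContact

CLOSED (superseded) 2026-08-30T03:10:46Z by planner-rlead-bsd-VerticalContact-g2-0 — reason: superseded:route-BirchSwinnertonDyer-SelmerRank — superseded by route-BirchSwinnertonDyer-SelmerRank — note: rlead g2, ruling (457)(B): 389a1 (r_an=2) definite Gross period in the 7-adic Hida family has vertical slope EXACTLY 1 per depth at two admissible (p,K) = (7,Q(sqrt-31)) and (7,Q(sqrt-115)): v(P_N)-content = 1,2 at N = 0,1 (typed weights k=38/254, 26/170; rankW=1, exact eigenvectors resid=M, depth N. The file is kept as the record of this route; refuted decls are indexed as negative knowledge (`ledger negatives`).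

# Route VerticalContact — no excess rank from the vertical contact order of definite Gross periods
in the Hida family

BARRIER INVERSION (operator C). The catalogue leaves exactly one arithmetic avatar of a VANISHING
ORDER that is (a) not a Heegner point
(HeegnerPointsRankOne: torsion in r_an ≥ 2), (b) not a cyclotomic p-adic order
(PAdicHeightNondegeneracy: Schneider already in rank 1),
(c) not an anticyclotomic order (AnticyclotomicHeightDegeneracy: the height vanishes on E(ℚ) ×
E(ℚ)), (d) value-based, not sign-based
(FunctionalEquationParity, PAdicFunctionalEquationParity): the ORDER OF CONTACT at weight 2 of the
WEIGHT family (Hida) of definite toric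
(Gross) periods — Disegni's universal toric period 𝒫 / Longo–Vigni's 𝓙₀ ∈ 𝓡 — whose rank-1 case is a
THEOREM (BertoliniDarmon2007: order
exactly 2 of 𝒫² ⇔ L'(E/K,1) ≠ 0) and whose conjectured order is the Pfaffian of a SKEW weight-height
(Disegni2022 Conj. Pf, §7.3). It
suffices to show X = UB ∧ LB: (UB, new) for every E/ℚ (global minimal W) with a prime of
multiplicative reduction there are a good
ordinary big-image p ≥ 5 and an imaginary quadratic K in the definite configuration (N = N⁺N⁻, ν(N⁻)
odd inert, N⁺ and p split,
d_K < −4, r_an(E^{d_K}) ≤ 1) such that the weight-k p-ordinary quaternionic eigenforms Φ_k ≡ f_E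
(mod p^{N+1}), k = 2 + 2(p−1)p^N·h_K·t, with the coefficient field F_N ⊇ K(Φ_k) chosen PER DEPTH
(rev 4),
have twisted conductor-one Gross periods P_K(Φ_k) of 𝔓-adic order (minus content) ≤ m(N+1) + O(1)
with 2m ≤ r_an(E) + r_an(E^{d_K})
(crux VerticalContact); the Selmer side (crux VerticalSelmerBound: (N+1)·(corank Sel_{p^∞}(E) +
corank Sel_{p^∞}(E^{d_K})) ≤ 2·order + O(1),
from congruence of residual Selmer groups along the family and the anticyclotomic main conjecture
for every member, CastellaKimLongo2017
Cor. 3) then gives corank Sel_{p^∞}(E/ℚ) ≤ r_an(E); (LB) r_an ≤ corank and Ш[p^∞] finite are the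
cruxes SelmerRankLB / SelmerRankShaPFinite
shared verbatim with routes SelmerRank / ToricShedding / FrozenTwin, the potentially-good sector (no
multiplicative prime) is the sector crux
PGSelmerBSD, and GZK for the auxiliary twist is the shared support TwistRankLeOne. No card realised
(the index has no weight-family / Hida card). REV 1 (cone repair, 2026-08-17): the two quaternionic
items
(VerticalContact, VerticalSelmerBound) are typed over Mathlib only — rationals a, b < 0 with (a,b)_ℚ
⊗ ℚ_q a division algebra iff q ∣ N⁻
(the definite algebra B of discriminant N⁻), an Eichler order O = O₁ ∩ O₂ ⊆ B of level N⁺ (O₁, O₂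
maximal ℤ-orders, [O₁ : O] = N⁺), the
invertible right O-ideals RI (full ℤ-lattices J with O_R(J) = O, J J′ = O_L(J), J′J = O), a
conductor-one Gross point as a pair (ψ : K → B,
I₁ ∈ RI) with ψ(K) ∩ O_L(I₁) = ψ(O_K) and its Pic(O_K)-translates ψ(𝔞)I₁ — the dictionary of route
ToricShedding rev 3, same mathematics —
so the route file no longer imports Literature.NumberTheory.EllipticCurves.GrossPoints, whose module
cone (BrandtXi → JordanZassenhaus →
QuaternionAlgebraAdelic → AdelicGroupData; BrandtModuleMultiplicativity → BrandtModule) carries the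
unrelated unproved facts
AdelicGroupData.IsDiscreteRational / exists_isAutomorphicMeasure_units / brandtModule_massFormula
that blocked staffing.
Lean: `(∀ (W : WeierstrassCurve ℚ) [W.IsElliptic] [W.IsGloballyMinimal], (∃ (q : ℕ) (_ : Fact
q.Prime), W.HasMultiplicativeReductionAtPrime q) → ∃ (p : ℕ) (_ : Fact p.Prime), 5 ≤ p ∧
W.HasGoodReductionAtPrime p ∧ ¬ (p : ℤ) ∣ W.frobeniusTrace p ∧ W.HasSurjectiveModNGaloisRep p ∧
W.selmerCorank p ≤ W.analyticRank) ∧ (∀ (W : WeierstrassCurve ℚ) [W.IsElliptic]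
[W.IsGloballyMinimal] (p : ℕ) [Fact p.Prime], 5 ≤ p → W.HasGoodReductionAtPrime p → ¬ (p : ℤ) ∣
W.frobeniusTrace p → W.HasSurjectiveModNGaloisRep p → W.analyticRank ≤ W.selmerCorank p)`

## Assembly
Bookkeeping, ALL inside the crux-only deciding theorem `closes : VerticalContact →
VerticalSelmerBound → SelmerRankShaPFinite → SelmerRankLB →
PGSelmerBSD → TwistRankLeOne → BirchSwinnertonDyer` (Sketch.lean / glue.lean, lean check rc 0, 0
sorries): multiplicative sector — run both
vertical items at depth N = C + C′: (N+1)(corank E + corank E^{d_K}) ≤ j + C′ and j ≤ 2m(N+1) + C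
give corank E + corank E^{d_K} ≤ 2m ≤
r_an(E) + r_an(E^{d_K}) (ℕ-arithmetic), TwistRankLeOne gives r_an(E^{d_K}) ≤ corank E^{d_K}, so
corank E ≤ r_an E at the contact prime, and
SelmerRankLB there gives equality; potentially-good sector — PGSelmerBSD; then Ш[p^∞] finite ⇒
shaCorank = 0
(Literature.BSD.shaCorank_eq_zero_of_finite), Greenberg's identity
(selmerCorank_eq_mordellWeilRank_add_holds), transport of rank /
Euler factors / analytic rank along a global minimal model (hasGlobalMinimalModel_rat_holds; AEC
III.3.1(b), VII.1.3, App. C §16,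
re-derived inline verbatim as in route ToricShedding's certified closes) and
Literature.BSD.selmerCorank_identity_imp_thesis_imp_bsd.
The assembly item below is the type of closes (closable by `fun a b c d e f => closes a b c d e f`);
7 items, 6 binders, all consumed.

Rationale: WHY THIS LINE. Mechanism: put f_E in its Hida family at a good ordinary p split in a sign(+1)
imaginary quadratic K; on the definite quaternion algebra of
discriminant N⁻ the compatible Gross points of LongoVigni2010 (Thm 1.1) give a canonical element 𝓙₀
of the weight algebra 𝓡 whose
specialisation at an arithmetic weight k is the (BDP/Hecke-twisted) Gross period P_K(Φ_k) of the
weight-k member and whose square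
interpolates central values L(F_k/K, ξ_k, k/2) (CastellaKimLongo2017 §3, Castella–Longo); arithmetic
weights k ≡ 2 (mod (p−1)p^N) ACCUMULATE at
k = 2 p-adically, so the order of vanishing of 𝓙₀ at the weight-2 point — the CONTACT ORDER m — is
read off the p-adic decay of these
classical values, and Hida's congruences transfer it to Selmer groups: Sel(K, E[p^{N+1}]) = Sel(K,
T†_{Φ_k}/p^{N+1}) is bounded by
|P_K(Φ_k)|^{-2} through the anticyclotomic main conjecture of EVERY member (BertoliniDarmon2005 +
PollackWeston2011 + SkinnerUrban2014 at
weight 2, propagated by CastellaKimLongo2017 Cor. 3), whence corank Sel_{p^∞}(E/K) ≤ 2m. The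
archimedean↔p-adic bridge is posited ONLY
as 2m ≤ ord_{s=1} L(E/K, s): Disegni2022 Conj. Pf predicts ord = ⌊r̃/2⌋ with r̃ the extended Selmer
rank and Pfaffian leading term, the
rank-0 case is Gross's formula and the rank-1 (exceptional) case is BertoliniDarmon2007 /
Castella2016 — the only theorems in print where
an arithmetic family detects a central DERIVATIVE without a height hypothesis. Imported area: Hida
theory / p-adic deformation of
automorphic periods (vertical Iwasawa theory, Delbourgo2008 §7.3, Conj. 7.18–7.19). What no listed
route does: every p-adic route of the
summit (PAdicOrderV2, LeadingTerm, SelmerRank) reads the CYCLOTOMIC variable and meets Schneider;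
the two definite-quaternionic routes
(ToricShedding, FrozenTwin) deform the LEVEL (admissible / class-group congruences) at fixed weight
2; none varies the weight.

RANKED CRUXES. #2 VerticalContact (crux; rev 1: Mathlib-only typing; rev 4: coefficient data (F, 𝔓,
ι, e, e′) under ∀N + on-branch weight clause 2(p−1)p^N·h_K ∣ k−2, after refuters rreview/rattack and
Hida JAMS 24 (2011)) — for every elliptic E/ℚ (global minimal W) with a multiplicative prime there
are p, K, N⁺, N⁻, rationals a, b < 0 with B = (a,b)_ℚ ramified exactly at the primes of N⁻, an
Eichler order O ⊆ B of level N⁺ (intersection of two maximal ℤ-orders, index N⁺), a conductor-one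
Gross point (ψ : K → B, I₁ an invertible right O-ideal, ψ(K) ∩ O_L(I₁) = ψ(O_K)), ideal-class
representatives a₀ (prime to p) with generators α_c of (a₀ c)^h, a contact order m with 2m ≤ r_an(E)
+ r_an(E^{d_K}), r_an(E^{d_K}) ≤ 1, and C, such that for every depth N there are a coefficient
number field F ⊇ K with a prime 𝔓 ∣ p, a splitting ι : B → M₂(F) integral on O, 𝔓-primitive torus
eigen-row-vectors e, e′ (det a unit) and a weight k (2 < k, 2(p−1)p^N·h ∣ k−2) that carries a
Bˣ-equivariant Sym^{k−2}-valued Hecke eigenform Φ on the right ideals (all T_q, q ∤ N), congruent to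
f_E mod p^{N+1}, p-ordinary, non-zero on a p-trivial ideal, whose twisted Gross period P = Σ_c
α_c^{−(k−2)/h}·Φ(ψ(a₀ c)I₁)(e) satisfies 2(v_𝔓(P) − content) ≤ 2m(N+1) + C. [difficulty:
open-problem] (why it might fail: Conjecturally 2(v−content) = corank Sel(E/K)·(N+1): false iff
excess Selmer rank / corank Ш[p^∞] > 0 at every admissible (p,K), or the skew weight-height (Disegni
Pf) degenerates on E(ℚ) like the anticyclotomic one; an inline convention (Sym^{k−2} Hecke action,
twist exponent) may mis-state.) [BertoliniDarmon2007, Disegni2022, LongoVigni2010,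
CastellaKimLongo2017, Castella2016, Gross1987, BertoliniDarmon1996]
#3 VerticalSelmerBound (crux; rev 4: ∃C′ hoisted above the coefficient data, on-branch weight
clause) — LITERATURE LEAF (Selmer side). In the F-free data and hypotheses of VerticalContact there
is C′ such that for every coefficient datum (F, 𝔓, ι, e, e′), every depth N and every admissible
on-branch weight-k form Φ (same conjunction) some normalising pair (I₀, e₀) and exponent j satisfy
val(P)² ≤ val(Φ(I₀)(e₀))²·val(p)^j and (N+1)·(corank Sel_{p^∞}(E/ℚ) + corank Sel_{p^∞}(E^{d_K}/ℚ)) ≤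
j + C′ — i.e. Sel(K, E[p^{N+1}]) ≅ Sel(K, T†_Φ/p^{N+1}) (ρ_Φ ≡ ρ_E mod p^{N+1}, same ordinary line)
is bounded by |P|^{−2}·p^{C′} through the anticyclotomic main conjecture for Φ and control at the
trivial character, uniformly in k (CKL2017 Cor. 3 over BD2005 / PW2011 / SU2014 at weight 2;
corank(E/K) = corank(E) + corank(E^{d_K}), DD2010 Lem. 4.14). [deps: VerticalContact] [difficulty:
XL] (why it might fail: Uniformity in k of the control/Tamagawa error needs (CR)-type vanishing of
local terms (p ∤ v_q(Δ) at q ∣ N⁻, big image); CKL Cor. 3 needs the IMC for one member (SU2014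
hypotheses) and p ∤ h_K; conductor-1 newform period vs CKL's 𝓛(𝔪,N)(𝟙) differ by an Euler factor
(unit for k > 2).) [CastellaKimLongo2017, BertoliniDarmon2005, PollackWeston2011, SkinnerUrban2014,
ChidaHsieh2014, DokchitserDokchitserAnnals2010]
#4 SelmerRankShaPFinite (crux) — p-primary Tate–Shafarevich finiteness, prime by prime (shared
verbatim with routes SelmerRank / ToricShedding / FrozenTwin; the LB input every corank route must
carry, SelmerVersusMordellWeilNarrow). [difficulty: open-problem] (why it might fail: Known only for
r_an ≤ 1 (Kolyvagin1990 Thm A, Kato2004 Thm 14.2); for r_an ≥ 2 nothing excludes an infinitely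
divisible element of Ш at every p; far stronger than the one-prime cotorsion the glue consumes.)
[Kolyvagin1990, Kato2004, SilvermanAEC2009, GreenbergLNM1716]
#5 SelmerRankLB (crux) — lower-bound half of p^∞-Selmer BSD at a good ordinary big-image prime
(shared verbatim with routes SelmerRank / ToricShedding / FrozenTwin); consumed at the contact
prime. [difficulty: open-problem] (why it might fail: Theorem for r_an ≤ 3 (corank-0/1 converses
SkinnerUrban2014 / BurungaleEtAl2026 + p-parity); OPEN from r_an = 4: needs Selmer classes out of
high-order vanishing, and the vertical family only bounds coranks from above.) [BurungaleEtAl2026,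
SkinnerUrban2014, Kato2004, DokchitserDokchitserAnnals2010]
#6 PGSelmerBSD (crux) — POTENTIALLY-GOOD SECTOR: for E/ℚ (global minimal W) with NO prime of
multiplicative reduction (integral j; all CM curves) there is a prime p with corank_{ℤ_p}
Sel_{p^∞}(E/ℚ) = r_an(E). The definite algebra of the contact mechanism needs an odd number of
multiplicative primes in N⁻, so this sector is delegated (it is Selmer-rank BSD on the integral-j
class; intended mechanism: the indefinite twin — Howard's big Heegner point over a Heegner K,
Howard2006 Thm B, whose contact order plays the role of 𝓙₀). [difficulty: open-problem] (why it
might fail: It is Selmer-BSD (both halves) on the integral-j class, open from min(corank, r_an) ≥ 2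
exactly as the whole conjecture; CM curves have no surjective p, so the big-image converses do not
even start.) [Howard2006, Howard2007, Zhang2014, SkinnerUrban2014, BurungaleEtAl2026]
#9 TwistRankLeOne (support) — LITERATURE LEAF (Gross–Zagier–Kolyvagin read on the Selmer side;
shared verbatim with route ToricShedding): r_an(V) ≤ 1 ⇒ r_an(V) ≤ corank Sel_{p^∞}(V/ℚ); consumed
for the auxiliary twist E^{d_K}. [difficulty: L] [GrossZagier1986, Kolyvagin1990,
BumpFriedbergHoffstein1990, MurtyMurty1991]

TWO-LAYER PLAN. Foreseen glued splits (not filed): VerticalContact ⇐ FamilySupply (existence of (p,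
K, a, b, O, ψ, I₁, a₀, α) and, at every depth, of (F, 𝔓, ι, e, e′, Φ_k):
Hida theory on the definite algebra, LongoVigni2010 §§5–6, CKL2017 Thm 3.1/3.4, plus a twist with
r_an(E^{d_K}) ≤ 1 and prescribed
splitting, BumpFriedbergHoffstein1990 / MurtyMurty1991) → ContactAllBranches (the bound for every
admissible Φ) → VerticalContact
(bc/VerticalContact_birth.lean, composition proved); VerticalSelmerBound ⇐ BoundOverK (with corank
Sel_{p^∞}(E/K)) → QuadraticCorank
(DD2010 Lem. 4.14 in the route's data) → VerticalSelmerBound (bc/VerticalSelmerBound_birth.lean);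
PGSelmerBSD ⇐ PGUB → PGLB (bc/PGSelmerBSD_birth.lean).

KILL CRITERIA. A computation (Cheapest falsifier) showing 2(v_𝔓(P_k) − content) ≥ 3(N+1) for N =
0,1,2 on a rank-2 curve with r_an(E/K) = 2 at two
admissible (p, K) refutes VerticalContact as stated (close refuted:VerticalContact, hand the data to
Disegni-Pf as a degeneracy of the
weight-height on E(ℚ)); a proof that the skew weight-height vanishes identically on E(ℚ)-classes (as
the anticyclotomic one does) kills the
line outright. A misnormalisation found by a grounder (Hecke action on Sym^{k−2}, twist exponent, e
vs e′) ⇒ restate (misstated, not false).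
VerticalSelmerBound refuted substantively (no uniform C′) ⇒ pivot to the over-K statement with
explicit Tamagawa terms. SelmerRankUB proved
elsewhere (corank ≤ r_an at one big-image p for all E) moots the UB half; SelmerRank's thesis proved
moots the route.

NOT DECOMPOSED YET. The supply lemma (existence of the Hida-family data at every depth) and the
uniform constants are layer-2 children; PGSelmerBSD's picked line
(Cruxes/PGSelmerBSD/Lines/Sketch.lean: free-order-minimal prime + Kato Thm 18.4 + SelmerRankLB +
SelmerRankCM + GZK) leans on Kato's divisibility, carried as the SHARED item KatoDivisibility of
routes LeadingTerm / PAdicOrderV2 (dropped here in rev 3 as not consumed by closes; a glued split of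
PGSelmerBSD naming it is the tenure move if that line closes modulo Kato); the indefinite twin
(Howard's big Heegner point, contact order over a Heegner K, r_an(E/K) odd) that would replace
PGSelmerBSD by the same mechanism is a
second route if this one survives; the leading-term (Pfaffian) formula is deliberately NOT posited —
only the inequality on the order.

CHEAPEST FALSIFIER. E = 389a (rank 2, conductor 389 prime ⇒ N⁻ = 389, N⁺ = 1), p = 5 (good ordinary,
surjective), K = ℚ(√−d) with 389 inert, 5 split,
L(E^{−d},1) ≠ 0: compute the weight-k quaternionic eigenforms Φ_k on the definite algebra of
discriminant 389 for k = 10, 42 (= 2 + 2·4·5^N,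
N = 0, 1; Magma HilbertCuspForms(ℚ, 389, k) / Dembélé's definite algorithm), congruent to f_{389a}
mod 5^{N+1}, and v_5 of the twisted
Gross period minus content: the crux predicts ≤ 2(N+1) + O(1) (contact order m = 1, i.e. 𝓙₀ has a
SIMPLE zero at weight 2); Lean-side the
rank-0 anchor (contact order 0 ⇔ L(E/K,1) ≠ 0, Gross's formula) is the first special case to
certify. Not run here (no Magma on the hub;
a kit job needs a weight-k Brandt-module implementation — filed as the refuter's first task).

NUMBERS. Contact order predicted by Disegni2022 Conj. Pf at the weight-2 point: ⌊r̃/2⌋ with r̃ =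
corank Sel_{p^∞}(E/K) (+2e_s+e_ns at exceptional p; here
e = 0): r_an(E/K) = 0 ⇒ 0 (Gross1987 §11, theorem), = 1 (exceptional, p ∥ N inert) ⇒ 𝒫² of order
exactly 2 (BertoliniDarmon2007, theorem),
= 2 ⇒ 1 (first open case: 𝓙₀′(2) ≠ 0), = 4 ⇒ 2. Known Selmer-side inputs: μ = 0 and λ-constancy on
branches (CastellaKimLongo2017 Thm 2),
IMC for all k ≡ 2 mod p−1 given one member (Cor. 3), generic rank 1/0 dichotomy (Howard2007;
Delbourgo2008 Ex. 7.20). Items at open: 6.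

DEFINITION REQUESTS. None filed. Rev 0 typed the two quaternionic items over the tree's
Brandt.XiSetup / GrossRep / Brandt.rightIdeals; rev 1 (cone
repair, 2026-08-17) inlines them over Mathlib (QuaternionAlgebra ℚ a 0 b, Eichler order as an
intersection of two maximal ℤ-orders of index N⁺,
invertible right O-ideals, Hecke operators as sums over right-O-stable sublattices of index q²,
Gross points (ψ, I) and ψ(𝔞)I — the
dictionary of ToricShedding rev 3), because those tree notions live in modules importing
QuaternionAlgebraAdelic → AdelicGroupData and
BrandtModule, whose unrelated unproved facts blocked staffing; weight-k forms, the Sym^{k−2}-action,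
Hecke sums and the twisted period stay
inlined. Wanted (shared with ToricShedding's D2): an ADELIC-FREE Brandt / Gross-point package
(Eichler orders, right-ideal classes, Hecke
operators, Gross points of QuaternionAlgebra ℚ a 0 b over Mathlib only, Gross 1987 §3) in a module
NOT importing QuaternionAlgebraAdelic —
it would shorten both items (topic Literature/NumberTheory/Automorphic). Wanted later (layer 2): a
tree notion of weight-k quaternionic eigenform / Λ-adic Gross period 𝓙₀ (LongoVigni2010 §6) to
shorten the items; acquisition acq-06598 (Castella–Longo 2016, the value formula) is open.

Novelty: Searches (2026-08-17): local lit searchd DOWN all session (ConnectionReset), OpenAlex/S2/arXiv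
rate-limited; ran `lit galaxy search` (panama:
Delbourgo2008 located and read: Intro, §7.3 Conj. 7.18/7.19, Ex. 7.20, §10.5), `lit read
arxiv:1507.04260` (Castella2016, §§1,3 read),
`lit read arxiv:2001.00045` (Disegni2022 §7.3 read: Conj. Pf, §7.3.3–7.3.5), `lit read
10.1007/s00229-010-0409-6` (LongoVigni2010 §1 read),
`lit read 10.2140/ant.2017.11.2339` (CastellaKimLongo2017 §§1–3 read), `lit cite` ×6 (bib added:
LongoVigni2010, Castella2016,
CastellaKimLongo2017, Disegni2022); tree: all 9 Theses of the sub, the 10 barrier files,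
Cruxes/*/Ideas (16 crux ideas incl. hida-weight-edge
and its r2 census), negatives (1 entry); `lean search` for every constant.
Nearest prior art found: Disegni2022 Conj. Pf (order of the universal toric period = ⌊r̃/2⌋ with the
SELMER rank, Pfaffian leading term) and
BertoliniDarmon2007 (its weight-direction rank-1 case); on the Selmer side CastellaKimLongo2017 /
LongoVigni2010; in-summit: crux idea
hida-weight-edge (good ordinary, cyclotomic edge line, rank 1 — reduced to Schneider by its own
census) and route ToricShedding (definite toric
periods, LEVEL deformation).
Delta: replace r̃ by the analytic rank in the BD/Disegni vanishing-order conjecture for the definite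
weight family, transfer the order to Selmer
coranks by Hida congruences + CKL, and read BSD's upper bound off the contact order — a p-adic
family comparison whose rank-1 instance is a
theor  [refs: 10.1007/s00229-010-0409-6`, 10.2140/ant.2017.11.2339`, 1507.04260, 2001.00045, arxiv:1507.04260, arxiv:2001.00045, Delbourgo2008, Castella2016, Disegni2022, LongoVigni2010, CastellaKimLongo2017, BertoliniDarmon2007]

Barriers (technique_class: hida-families, definite-toric-periods, contact-order): - technique_class: hida-families, definite-toric-periods, vertical-contact-order, big-heegner-points
- Literature.Barriers.BirchSwinnertonDyer.HeegnerPointBarrier: no Heegner point is used — K is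
chosen with sign(E/K) = +1 (definite), and the rank is read from the ORDER OF VANISHING of a period
family at weight 2, which is ≥ 1 exactly when the Heegner-type supply is torsion; the barrier's
narrow form (derived classes allowed) is the resource: the derivative classes live in the weight
direction.
- Literature.Barriers.BirchSwinnertonDyer.AnticyclotomicHeightDegeneracy: evaded by direction —
complex conjugation acts trivially on the weight variable, so the weight component of the
Nekovář–Venerucci pairing has no forced radical on E(ℚ); the anticyclotomic component (which
vanishes on E(ℚ)×E(ℚ)) is never used.
- Literature.Barriers.BirchSwinnertonDyer.PAdicHeightBarrier: it does not bite formally (technique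
class = unit-root cyclotomic height at ordinary p; here the relevant non-degeneracy is the Pfaffian
of the SKEW weight-height of Disegni2022 §7.3.1) — honestly: the bet is that this different
invariant (one number h^{wt}(P,Q) in rank 2, a theorem-anchored family in rank 1) is more tractable
than Schneider; no claim that it is known.
- Literature.Barriers.BirchSwinnertonDyer.ExceptionalZeroBarrier: p is GOOD ordinary (no trivial
zero in any variable used); the exceptional case is cited only as the proved anchor
(BertoliniDarmon2007, Castella2016) where the Euler factor is stripp

History (route lifecycle, newest last):
- 2026-08-17T02:32:43Z · rev 1: restated VerticalContact (stmt-BirchSwinnertonDyer-17808), VerticalSelmerBound (stmt-BirchSwinnertonDyer-17809) — rev 1 (cone repair, route-repair unit rrepair-BirchSwinnertonDyer-VerticalCo-81f462b6): restate VerticalContact + VerticalSelmerBound over Mathlib only (Quatern (planner-rrepair-BirchSwinnertonDyer-VerticalCo-81f462b6-0)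
- 2026-08-17T12:50:18Z · rev 3: dropped KatoDivisibility — route-repair unused-crux (rrepair-6946c063, rev 3): DROP KatoDivisibility (stmt-18082) from this route. It is not consumed by closes (the potentially-good secto (planner-rrepair-BirchSwinnertonDyer-VerticalCo-6946c063-0)
- 2026-08-17T13:01:32Z · rev 4: restated VerticalContact (stmt-BirchSwinnertonDyer-18431), VerticalSelmerBound (stmt-BirchSwinnertonDyer-18432) — rev 4 (route-repair rrepair-6946c063, planner restate requested by five seats): RESTATE VerticalContact (stmt-18431) and VerticalSelmerBound (stmt-18432), both (planner-rrepair-BirchSwinnertonDyer-VerticalCo-6946c063-0)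
- 2026-08-26T09:03:12Z · DORMANT — reconciler: no traction for 8.4 d (last activity item-evidence-added at 2026-08-17T22:57:09Z); parked, not closed — `ledger route dormant route-BirchSwinnertonD (operator:999:2792723)
- 2026-08-29T10:27:54Z · REACTIVATED — reconciler: reactivated — activity statement-checked at 2026-08-29T09:26:40Z after parking at 2026-08-26T09:03:12Z (operator:999:2343202)
- 2026-08-30T03:10:46Z · CLOSED superseded — superseded:route-BirchSwinnertonDyer-SelmerRank (planner-rlead-bsd-VerticalContact-g2-0)

sub-problem: BirchSwinnertonDyer · status: closed(superseded) · opened planner-plan-novel-BirchSwinnertonDyer-BirchSwi-5bb0a642-c-v2-g17-0 2026-08-17T02:12:08Z · rev 4 · ledger route-BirchSwinnertonDyer-VerticalContact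
GENERATED by the gate from the ledger (D-0016/17). Provers cite these decls: `theorem foo : Summit.BirchSwinnertonDyer.BirchSwinnertonDyer.Theses.VerticalContact.<Decl> := …` in Summits/BirchSwinnertonDyer/BirchSwinnertonDyer/Theorems/<Name>.lean.
-/

namespace Summit.BirchSwinnertonDyer.BirchSwinnertonDyer.Theses.VerticalContact

open scoped BigOperators Topology Manifold Classical MeasureTheory ProbabilityTheory Matrix InnerProductSpace ComplexConjugate ContinuousMap
open Filter Set Function TopologicalSpace MeasureTheory

attribute [summit_statement] _root_.BirchSwinnertonDyer

open Literature

-- earlier VerticalContact (stmt-BirchSwinnertonDyer-17808, replaced 2026-08-17T02:32:43Z -> stmt-BirchSwinnertonDyer-18431): retired by None — ∀ (W : WeierstrassCurve ℚ) [W.IsElliptic] [W.IsGloballyMinimal], (∃ (q : ℕ) (_ : Fact q.Prime), W.HasMultiplicativeReductionAtPrime q) → ∃ (p : ℕ) (_ : Fact p.Prime) (K : Type) (_ : Field K) (_ : NumberField K) (Nplus Nminus : ℕ) (S : Literature.NumberTheory.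
-- earlier VerticalContact (stmt-BirchSwinnertonDyer-18431, replaced 2026-08-17T13:01:32Z -> stmt-BirchSwinnertonDyer-18130): retired by None — ∀ (W : WeierstrassCurve ℚ) [W.IsElliptic] [W.IsGloballyMinimal], (∃ (q : ℕ) (_ : Fact q.Prime), W.HasMultiplicativeReductionAtPrime q) → ∃ (p : ℕ) (_ : Fact p.Prime) (K : Type) (_ : Field K) (_ : NumberField K) (Nplus Nminus : ℕ) (a b : ℚ), let B := Quaternio
/-- item stmt-BirchSwinnertonDyer-18130 · crux · rank 2 · closed · moot by None · by planner
why it might fail: Conjecturally 2(v−content) = corank Sel(E/K)·(N+1): false iff excess Selmer rank / corank Ш[p^∞] > 0 at every admissible (p,K), or the weight-height degenerates on E(ℚ) (odd r_an(E): census D2 parity hazard); an inline convention (Sym^{k−2} action, twist exponent) may still mis-state.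
sources: BertoliniDarmon2007, Disegni2022, LongoVigni2010, CastellaKimLongo2017, Castella2016, Gross1987
[crux] (rev 4 restate — R1: the coefficient data (F ⊇ K, 𝔓 ∣ p, ι, e, e′) and their two clauses are
bound UNDER ∀N, because the Hecke fields of the p-ordinary non-CM congruent eigenforms of weights
k_N → ∞ are not contained in one number field (Hida, JAMS 24 (2011) Thm 3.2 / Cor 6.3 / Conj 8.1;
refuters rreview 02:45Z, rattack 05:24Z, strategist census D1, leads 11:43Z/12:45Z); R2: on-branch
weight clause 2(p−1)p^N·h_K ∣ k−2, so the toric twist α_c^{−(k−2)/h_K} is ≡ 1 mod 𝔓^{N+1}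
(rattack-18432, Theorems/VerticalSelmerBound/Negative/WeightClause.lean). Same mathematics
otherwise; rev-1 Mathlib-only typing of the definite set-up kept: rationals a, b < 0 with (a,b)_ℚ ⊗
ℚ_q a division algebra iff q ∣ N⁻, an Eichler order O = O₁ ∩ O₂ of level N⁺, invertible right
O-ideals RI, a conductor-one Gross point (ψ, I₁) and its Pic(O_K)-translates ψ(a₀ c)I₁.) For every
elliptic E/ℚ (global minimal W) with a multiplicative prime there are p, K, N⁺, N⁻, (a, b, O), a
conductor-one Gross point (ψ, I₁), ideal-class representatives a₀ (prime to p) with generators α_c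
of (a₀ c)^h whose translates are again p-trivial conductor-one Gross points, a contact order m with
2m ≤ r_an(E) + r_an(E^{d_K}), r_an( -/
@[route_item "route-BirchSwinnertonDyer-VerticalContact", crux]
def VerticalContact : Prop :=
  ∀ (W : WeierstrassCurve ℚ) [W.IsElliptic] [W.IsGloballyMinimal], (∃ (q : ℕ) (_ : Fact q.Prime), W.HasMultiplicativeReductionAtPrime q) → ∃ (p : ℕ) (_ : Fact p.Prime) (K : Type) (_ : Field K) (_ : NumberField K) (Nplus Nminus : ℕ) (a b : ℚ), let B := QuaternionAlgebra ℚ a 0 b; let R := NumberField.RingOfIntegers K; ∃ (O : Subring B) (ψ : K →ₐ[ℚ] B) (I₁ : Submodule ℤ B) (a₀ : ClassGroup R → nonZeroDivisors (Ideal R)) (α : ClassGroup R → R) (m C : ℕ), let Λ := Submodule ℤ B; let hK := NumberField.classNumber K; let dK := NumberField.discr K; let spl : ℕ → ℕ := fun q => ((Ideal.span {(q : ℤ)}).primesOver R).ncard; let RI : Set Λ := {J | J.FG ∧ (∀ d : B, ∃ n : ℤ, n ≠ 0 ∧ n • d ∈ J) ∧ (∀ x : B, (∀ y ∈ J, y *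 x ∈ J) ↔ x ∈ O) ∧ ∃ J' : Λ, (∀ x : B, x ∈ J * J' ↔ ∀ y ∈ J, x * y ∈ J) ∧ (∀ x : B, x ∈ J' * J ↔ x ∈ O)}; let PT : Λ → Prop := fun I => ∃ n₀ : ℕ, n₀.Coprime p ∧ (∀ x ∈ O, (n₀ : ℤ) • x ∈ I) ∧ ∀ x ∈ I, (n₀ : ℤ) • x ∈ O; let L : ClassGroup R → Λ := fun c => Submodule.span ℤ ((fun x : R => ψ (x : K)) '' (a₀ c).1) * I₁; let HG : Λ → Prop := fun J => J ∈ RI ∧ (∀ x : R, ∀ y ∈ J, ψ (x : K) * y ∈ J) ∧ ∀ x : K, (∀ y ∈ J, ψ x * y ∈ J) → ∃ z : R, (z : K) = x; ((5 ≤ p ∧ W.HasGoodReductionAtPrime p ∧ ¬ (p : ℤ) ∣ W.frobeniusTrace p ∧ W.HasSurjectiveModNGaloisRep p ∧ ¬ p ∣ 6 * hK ∧ Int.gcd dK (W.conductorNorm ℤ * p) = 1) ∧ (Module.finrank ℚ K = 2 ∧ NumberField.IsTotallyComplex K ∧ dK < -4 ∧ spl p = 2) ∧ (W.conductorNorm ℤ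 = Nplus * Nminus ∧ Nat.Coprime Nplus Nminus ∧ Squarefree Nminus ∧ Odd Nminus.primeFactors.card ∧ (∀ q : ℕ, q.Prime → q ∣ Nplus → spl q = 2) ∧ (∀ q : ℕ, q.Prime → q ∣ Nminus → spl q = 1 ∧ ¬ (p : ℤ) ∣ padicValRat q W.Δ)) ∧ (a < 0 ∧ b < 0 ∧ (∀ (q : ℕ) [Fact q.Prime], (∀ x : QuaternionAlgebra ℚ_[q] (a : ℚ_[q]) 0 (b : ℚ_[q]), x ≠ 0 → IsUnit x) ↔ q ∣ Nminus) ∧ ∃ O₁ O₂ : Subring B, (∀ S : Subring B, (S = O₁ ∨ S = O₂) → (S.toAddSubgroup.FG ∧ (∀ d : B, ∃ n : ℤ, n ≠ 0 ∧ n • d ∈ S) ∧ ∀ S' : Subring B, S'.toAddSubgroup.FG → S ≤ S' → S' = S)) ∧ O = O₁ ⊓ O₂ ∧ O.toAddSubgroup.relIndex O₁.toAddSubgroup = Nplus) ∧ (HG I₁ ∧ ∀ c, ClassGroup.mk0 (a₀ c) = c ∧ IsCoprime (a₀ c).1 (Ideal.span {(p : R)}) ∧ Ideal.span {α c} = (a₀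 c).1 ^ hK ∧ HG (L c) ∧ PT (L c))) ∧ (2 * m ≤ W.analyticRank + (W.quadraticTwist (dK : ℚ)).analyticRank ∧ (W.quadraticTwist (dK : ℚ)).analyticRank ≤ 1) ∧ ∀ N : ℕ, ∃ (F : Type) (_ : Field F) (_ : NumberField F) (_ : Algebra K F) (𝔓 : IsDedekindDomain.HeightOneSpectrum (NumberField.RingOfIntegers F)) (ι : B →ₐ[ℚ] Matrix (Fin 2) (Fin 2) F) (e e' : Fin 2 → F) (k : ℕ) (lam : ℕ → F) (Φ : Λ → MvPolynomial (Fin 2) F), let val := 𝔓.valuation F; let PR : (Fin 2 → F) → Prop := fun w => (∀ i, val (w i) ≤ 1) ∧ ∃ i, val (w i) = 1; let ρ : Bˣ → MvPolynomial (Fin 2) F → MvPolynomial (Fin 2) F := fun β P => MvPolynomial.aeval (fun j : Fin 2 => ∑ i : Fin 2, MvPolynomial.X (R := F) i * MvPolynomial.C (ι β.1 i j)) P; (((p : NumberField.RingOfIntegers F) ∈ 𝔓.asIdeal ∧ ∀ x ∈ O, ∀ i j, val (ι x i j) ≤ 1) ∧ ((∀ t, Matrix.vecMul e (ι (ψ t))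 = (algebraMap K F t) • e) ∧ (∀ t, Matrix.vecMul e' (ι (ψ t)) = (algebraMap K F (Algebra.trace ℚ K t) - algebraMap K F t) • e') ∧ (∀ i, val (e i) ≤ 1) ∧ (∀ i, val (e' i) ≤ 1) ∧ val (e 0 * e' 1 - e 1 * e' 0) = 1)) ∧ ((2 < k ∧ 2 * (p - 1) * p ^ N ∣ k - 2 ∧ 2 * (p - 1) * p ^ N * hK ∣ k - 2) ∧ (∀ I ∈ RI, (Φ I).IsHomogeneous (k - 2)) ∧ (∀ (β : Bˣ), ∀ I ∈ RI, Φ (I.map (AddMonoidHom.mulLeft β.1).toIntLinearMap) = ρ β (Φ I)) ∧ (∀ q : ℕ, q.Prime → ¬ q ∣ Nplus * Nminus → ∀ I ∈ RI, ∑ᶠ J ∈ {J : Λ | J ≤ I ∧ J.toAddSubgroup.relIndex I.toAddSubgroup = q ^ 2 ∧ ∀ y ∈ J, ∀ x ∈ O, y * x ∈ J}, Φ J = lam q • Φ I) ∧ (∀ q : ℕ, q.Prime → ¬ q ∣ Nplus * Nminus * p → val (lam q - (W.frobeniusTrace q : F)) ≤ val (p : F) ^ (N + 1)) ∧ val (lam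 p) = 1 ∧ ∃ I ∈ RI, PT I ∧ Φ I ≠ 0) ∧ ∀ I₀ ∈ RI, PT I₀ → ∀ e₀ : Fin 2 → F, PR e₀ → ∀ j : ℕ, val (∑ c, (algebraMap K F (α c : K))⁻¹ ^ ((k - 2) / hK) * MvPolynomial.eval e (Φ (L c))) ^ 2 ≤ val (MvPolynomial.eval e₀ (Φ I₀)) ^ 2 * val (p : F) ^ j → j ≤ 2 * m * (N + 1) + C

-- earlier VerticalSelmerBound (stmt-BirchSwinnertonDyer-17809, replaced 2026-08-17T02:32:43Z -> stmt-BirchSwinnertonDyer-18432): retired by None — ∀ (W : WeierstrassCurve ℚ) [W.IsElliptic] [W.IsGloballyMinimal] (p : ℕ) [Fact p.Prime] (K : Type) [Field K] [NumberField K] (Nplus Nminus : ℕ) (S : Literature.NumberTheory.Automorphic.Brandt.XiSetup Nplus Nminus) (F : Type) [Field F] [NumberField F] [Alge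
-- earlier VerticalSelmerBound (stmt-BirchSwinnertonDyer-18432, replaced 2026-08-17T13:01:32Z -> stmt-BirchSwinnertonDyer-18131): retired by None — ∀ (W : WeierstrassCurve ℚ) [W.IsElliptic] [W.IsGloballyMinimal] (p : ℕ) [Fact p.Prime] (K : Type) [Field K] [NumberField K] (Nplus Nminus : ℕ) (a b : ℚ), let B := QuaternionAlgebra ℚ a 0 b; let R := NumberField.RingOfIntegers K; ∀ (O : Subring B) (F : Typ
/-- item stmt-BirchSwinnertonDyer-18131 · crux · rank 3 · closed · moot by None · by planner
why it might fail: Uniformity of C′ in k and in the coefficient datum needs (CR)-type vanishing of local terms (p ∤ v_q(Δ) at q ∣ N⁻, big image) + residual Selmer rigidity; CKL Cor. 3 needs the IMC for one member (SU2014) and p ∤ h_K; the typed period has torus type t^{k−2} (census D2), not CKL's 𝓛(𝟙).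
sources: CastellaKimLongo2017, BertoliniDarmon2005, PollackWeston2011, SkinnerUrban2014, ChidaHsieh2014, DokchitserDokchitserAnnals2010
[crux] LITERATURE LEAF (Selmer side; rev 4 restate = verbatim the type of
ToricControl.VerticalSelmerBoundR_of in Cruxes/VerticalSelmerBound/Lines/toric_control.lean — R1:
∃C′ hoisted above the coefficient data (F, 𝔓, ι, e, e′), so C′ is uniform in them as well as in the
depth and the weight (needed by closes' diagonal N = C + C′ once VerticalContact produces F per
depth; it also removes the true-for-the-wrong-reason artefact of the rev-1 typing); R2: on-branch
weight clause 2(p−1)p^N·h_K ∣ k−2, excluding the off-character weights of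
Negative/WeightClause.lean). In the F-free data and hypotheses of VerticalContact there is C′ such
that for every coefficient datum, every depth N and every admissible on-branch weight-k form Φ (same
conjunction as VerticalContact) some normalising pair (I₀, e₀) and exponent j satisfy val(P)² ≤
val(Φ(I₀)(e₀))²·val(p)^j and (N+1)·(corank Sel_{p^∞}(E/ℚ) + corank Sel_{p^∞}(E^{d_K}/ℚ)) ≤ j + C′ —
i.e. Sel(K, E[p^{N+1}]) ≅ Sel(K, T†_Φ/p^{N+1}) is bounded by |P|^{−2}·p^{C′} through residual Selmer
rigidity, the anticyclotomic main conjecture for the newform behind Φ and control at the (now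
trivial mod 𝔓^{N+1}) character, uniformly in k and F (CKL2017 Cor. 3 -/
@[route_item "route-BirchSwinnertonDyer-VerticalContact", crux]
def VerticalSelmerBound : Prop :=
  ∀ (W : WeierstrassCurve ℚ) [W.IsElliptic] [W.IsGloballyMinimal] (p : ℕ) [Fact p.Prime] (K : Type) [Field K] [NumberField K] (Nplus Nminus : ℕ) (a b : ℚ), let B := QuaternionAlgebra ℚ a 0 b; let R := NumberField.RingOfIntegers K; ∀ (O : Subring B) (ψ : K →ₐ[ℚ] B) (I₁ : Submodule ℤ B) (a₀ : ClassGroup R → nonZeroDivisors (Ideal R)) (α : ClassGroup R → R), let Λ := Submodule ℤ B; let hK := NumberField.classNumber K; let dK := NumberField.discr K; let spl : ℕ → ℕ := fun q => ((Ideal.span {(q : ℤ)}).primesOver R).ncard; let RI : Set Λ := {J | J.FG ∧ (∀ d : B, ∃ n : ℤ, n ≠ 0 ∧ n • d ∈ J) ∧ (∀ x : B, (∀ y ∈ J, y * x ∈ J) ↔ x ∈ O) ∧ ∃ J' : Λ, (∀ x : B, x ∈ J * J' ↔ ∀ y ∈ J, x * y ∈ J) ∧ (∀ x : B, x ∈ J'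 * J ↔ x ∈ O)}; let PT : Λ → Prop := fun I => ∃ n₀ : ℕ, n₀.Coprime p ∧ (∀ x ∈ O, (n₀ : ℤ) • x ∈ I) ∧ ∀ x ∈ I, (n₀ : ℤ) • x ∈ O; let L : ClassGroup R → Λ := fun c => Submodule.span ℤ ((fun x : R => ψ (x : K)) '' (a₀ c).1) * I₁; let HG : Λ → Prop := fun J => J ∈ RI ∧ (∀ x : R, ∀ y ∈ J, ψ (x : K) * y ∈ J) ∧ ∀ x : K, (∀ y ∈ J, ψ x * y ∈ J) → ∃ z : R, (z : K) = x; ((5 ≤ p ∧ W.HasGoodReductionAtPrime p ∧ ¬ (p : ℤ) ∣ W.frobeniusTrace p ∧ W.HasSurjectiveModNGaloisRep p ∧ ¬ p ∣ 6 * hK ∧ Int.gcd dK (W.conductorNorm ℤ * p) = 1) ∧ (Module.finrank ℚ K = 2 ∧ NumberField.IsTotallyComplex K ∧ dK < -4 ∧ spl p = 2) ∧ (W.conductorNorm ℤ = Nplus * Nminus ∧ Nat.Coprime Nplus Nminus ∧ Squarefree Nminus ∧ Odd Nminus.primeFactors.card ∧ (∀ q : ℕ, q.Prime → q ∣ Nplus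 → spl q = 2) ∧ (∀ q : ℕ, q.Prime → q ∣ Nminus → spl q = 1 ∧ ¬ (p : ℤ) ∣ padicValRat q W.Δ)) ∧ (a < 0 ∧ b < 0 ∧ (∀ (q : ℕ) [Fact q.Prime], (∀ x : QuaternionAlgebra ℚ_[q] (a : ℚ_[q]) 0 (b : ℚ_[q]), x ≠ 0 → IsUnit x) ↔ q ∣ Nminus) ∧ ∃ O₁ O₂ : Subring B, (∀ S : Subring B, (S = O₁ ∨ S = O₂) → (S.toAddSubgroup.FG ∧ (∀ d : B, ∃ n : ℤ, n ≠ 0 ∧ n • d ∈ S) ∧ ∀ S' : Subring B, S'.toAddSubgroup.FG → S ≤ S' → S' = S)) ∧ O = O₁ ⊓ O₂ ∧ O.toAddSubgroup.relIndex O₁.toAddSubgroup = Nplus) ∧ (HG I₁ ∧ ∀ c, ClassGroup.mk0 (a₀ c) = c ∧ IsCoprime (a₀ c).1 (Ideal.span {(p : R)}) ∧ Ideal.span {α c} = (a₀ c).1 ^ hK ∧ HG (L c) ∧ PT (L c))) → ∃ C' : ℕ, ∀ (F : Type) [Field F] [NumberField F] [Algebra K F] (𝔓 : IsDedekindDomain.HeightOneSpectrum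 (NumberField.RingOfIntegers F)) (ι : B →ₐ[ℚ] Matrix (Fin 2) (Fin 2) F) (e e' : Fin 2 → F), let val := 𝔓.valuation F; let PR : (Fin 2 → F) → Prop := fun w => (∀ i, val (w i) ≤ 1) ∧ ∃ i, val (w i) = 1; let ρ : Bˣ → MvPolynomial (Fin 2) F → MvPolynomial (Fin 2) F := fun β P => MvPolynomial.aeval (fun j : Fin 2 => ∑ i : Fin 2, MvPolynomial.X (R := F) i * MvPolynomial.C (ι β.1 i j)) P; (((p : NumberField.RingOfIntegers F) ∈ 𝔓.asIdeal ∧ ∀ x ∈ O, ∀ i j, val (ι x i j) ≤ 1) ∧ ((∀ t, Matrix.vecMul e (ι (ψ t)) = (algebraMap K F t) • e) ∧ (∀ t, Matrix.vecMul e' (ι (ψ t)) = (algebraMap K F (Algebra.trace ℚ K t) - algebraMap K F t) • e') ∧ (∀ i, val (e i) ≤ 1) ∧ (∀ i, val (e' i) ≤ 1) ∧ val (e 0 * e' 1 - e 1 * e' 0) = 1)) → ∀ (N k : ℕ) (lam : ℕ → F) (Φ : Λ → MvPolynomial (Fin 2) F), ((2 < k ∧ 2 * (p - 1) * p ^ N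 ∣ k - 2 ∧ 2 * (p - 1) * p ^ N * hK ∣ k - 2) ∧ (∀ I ∈ RI, (Φ I).IsHomogeneous (k - 2)) ∧ (∀ (β : Bˣ), ∀ I ∈ RI, Φ (I.map (AddMonoidHom.mulLeft β.1).toIntLinearMap) = ρ β (Φ I)) ∧ (∀ q : ℕ, q.Prime → ¬ q ∣ Nplus * Nminus → ∀ I ∈ RI, ∑ᶠ J ∈ {J : Λ | J ≤ I ∧ J.toAddSubgroup.relIndex I.toAddSubgroup = q ^ 2 ∧ ∀ y ∈ J, ∀ x ∈ O, y * x ∈ J}, Φ J = lam q • Φ I) ∧ (∀ q : ℕ, q.Prime → ¬ q ∣ Nplus * Nminus * p → val (lam q - (W.frobeniusTrace q : F)) ≤ val (p : F) ^ (N + 1)) ∧ val (lam p) = 1 ∧ ∃ I ∈ RI, PT I ∧ Φ I ≠ 0) → ∃ I₀ ∈ RI, PT I₀ ∧ ∃ e₀ : Fin 2 → F, PR e₀ ∧ ∃ j : ℕ, val (∑ c, (algebraMap K F (α c : K))⁻¹ ^ ((k - 2) / hK) * MvPolynomial.eval e (Φ (L c))) ^ 2 ≤ val (MvPolynomial.eval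 e₀ (Φ I₀)) ^ 2 * val (p : F) ^ j ∧ (N + 1) * (W.selmerCorank p + (W.quadraticTwist (dK : ℚ)).selmerCorank p) ≤ j + C'

/-- item stmt-BirchSwinnertonDyer-0132 · crux · rank 4 · open · by planner
why it might fail: Known only for r_an ≤ 1 (Kolyvagin1990 Thm A, Kato2004 Thm 14.2); for r_an ≥ 2 nothing excludes an infinitely divisible element of Ш at every p; far stronger than the one-prime cotorsion the glue consumes.
sources: Kolyvagin1990, Kato2004, SilvermanAEC2009, GreenbergLNM1716
p-primary Tate–Shafarevich finiteness (weaker than Literature.BSD.ShaFiniteConjecture, prime by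
prime). Known when r_an ≤ 1 (Kolyvagin1990 Thm A; Kato2004 Thm 14.2 =
Literature.NumberTheory.EllipticCurves.kato_finite_of_L_one_ne_zero for r_an = 0). Tate1974 §1.
imports: Summits.BirchSwinnertonDyer.Statement,
Literature.NumberTheory.EllipticCurves.{Selmer,Sha,Heights,GaloisAction,Tamagawa,BSDInvariants}
(routes/Sketch.lean, lean check rc 0 on 2026-08-13). -/
@[route_item "route-BirchSwinnertonDyer-VerticalContact", crux]
def SelmerRankShaPFinite : Prop :=
  ∀ (W : WeierstrassCurve ℚ) [W.IsElliptic] (p : ℕ) [Fact p.Prime], Finite ↥(AddCommGroup.primaryComponent W.sha p)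

/-- item stmt-BirchSwinnertonDyer-0131 · crux · rank 5 · open · by planner
why it might fail: Theorem for r_an ≤ 3 (corank-0/1 converses SkinnerUrban2014 / BurungaleEtAl2026 + p-parity); OPEN from r_an = 4: needs Selmer classes out of high-order vanishing, and the vertical family only bounds coranks from above.
sources: BurungaleEtAl2026, SkinnerUrban2014, Kato2004, DokchitserDokchitserAnnals2010
Lower bound half of p^∞-Selmer BSD under Skinner2020-type hypotheses. Known when r_an ≤ 3
(SkinnerUrban2014 Thm 2 corank-0 converse, Skinner2020 Thm A corank-1 converse, p-parity
DokchitserDokchitser2010). imports: Summits.BirchSwinnertonDyer.Statement,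
Literature.NumberTheory.EllipticCurves.{Selmer,Sha,Heights,GaloisAction,Tamagawa,BSDInvariants}
(routes/Sketch.lean, lean check rc 0 on 2026-08-13). -/
@[route_item "route-BirchSwinnertonDyer-VerticalContact", crux]
def SelmerRankLB : Prop :=
  ∀ (W : WeierstrassCurve ℚ) [W.IsElliptic] [W.IsGloballyMinimal] (p : ℕ) [Fact p.Prime], 5 ≤ p → W.HasGoodReductionAtPrime p → ¬ (p : ℤ) ∣ W.frobeniusTrace p → W.HasSurjectiveModNGaloisRep p → W.analyticRank ≤ W.selmerCorank p

/-- item stmt-BirchSwinnertonDyer-17810 · crux · rank 6 · closed · moot by None · by planner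
why it might fail: It is Selmer-BSD (both halves) on the integral-j class, open from min(corank, r_an) ≥ 2 exactly as the whole conjecture; CM curves have no surjective p, so the big-image converses do not even start.
sources: Howard2006, Howard2007, Zhang2014, SkinnerUrban2014, BurungaleEtAl2026
[crux] POTENTIALLY-GOOD SECTOR: for E/ℚ (global minimal W) with NO prime of multiplicative reduction
(integral j; all CM curves) there is a prime p with corank_{ℤ_p} Sel_{p^∞}(E/ℚ) = r_an(E). The
definite algebra of the contact mechanism needs an odd number of multiplicative primes in N⁻, so
this sector is delegated (it is Selmer-rank BSD on the integral-j class; intended mechanism: the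
indefinite twin — Howard's big Heegner point over a Heegner K, Howard2006 Thm B, whose contact order
plays the role of 𝓙₀). [difficulty: open-problem] -/
@[route_item "route-BirchSwinnertonDyer-VerticalContact", crux]
def PGSelmerBSD : Prop :=
  ∀ (W : WeierstrassCurve ℚ) [W.IsElliptic] [W.IsGloballyMinimal], (¬ ∃ (q : ℕ) (_ : Fact q.Prime), W.HasMultiplicativeReductionAtPrime q) → ∃ (p : ℕ) (_ : Fact p.Prime), W.selmerCorank p = W.analyticRank

/-- item stmt-BirchSwinnertonDyer-15880 · support · rank 9 · open · by planner
sources: GrossZagier1986, Kolyvagin1990, BumpFriedbergHoffstein1990, MurtyMurty1991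
[support] LITERATURE LEAF (Gross–Zagier–Kolyvagin in analytic rank ≤ 1, read on the Selmer side):
for every elliptic V/ℚ and prime p, r_an(V) ≤ 1 ⇒ r_an(V) ≤ corank_{ℤ_p} Sel_{p^∞}(V/ℚ) (r_an = rank
by GrossZagier1986 I.6.3 + Kolyvagin1990 Thm A + BumpFriedbergHoffstein1990 / MurtyMurty1991, tree
fact rank_eq_analyticRank_of_analyticRank_le_one; rank ≤ corank by the proved tree theorem
selmerCorank_eq_mordellWeilRank_add_holds). Consumed for the quadratic twist E^{d_K}. [difficulty:
L] -/
@[route_item "route-BirchSwinnertonDyer-VerticalContact", crux]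
def TwistRankLeOne : Prop :=
  ∀ (V : WeierstrassCurve ℚ) [V.IsElliptic] (p : ℕ) [Fact p.Prime], V.analyticRank ≤ 1 → V.analyticRank ≤ V.selmerCorank p

/-- item stmt-BirchSwinnertonDyer-17811 · assembly · rank 1 · closed · moot by None · by planner
sources: CastellaKimLongo2017, GreenbergLNM1716
[assembly] VerticalContact → VerticalSelmerBound → SelmerRankShaPFinite → SelmerRankLB → PGSelmerBSD
→ TwistRankLeOne → BirchSwinnertonDyer (the type of closes, last arrow parenthesised —
definitionally the same term). -/
@[route_item "route-BirchSwinnertonDyer-VerticalContact"]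
def Assembly : Prop :=
  VerticalContact → VerticalSelmerBound → SelmerRankShaPFinite → SelmerRankLB → PGSelmerBSD → (TwistRankLeOne → _root_.BirchSwinnertonDyer)

/-! D-0027 §2.1 — DECIDING THEOREM (planner-authored via `route open/edit --closes-file`; by planner-rrepair-BirchSwinnertonDyer-VerticalCo-6946c063-0 2026-08-17T13:01:32Z) — ARCHIVED: route closed (superseded) 2026-08-30T03:10:46Z; kept so importers keep building:
its hypotheses are this route's items and its conclusion the sub-problem Statement (glue_lint), and it elaborates with this file. -/

@[closes "route-BirchSwinnertonDyer-VerticalContact"] theorem closes (hC : VerticalContact) (hB : VerticalSelmerBound) (hSha : SelmerRankShaPFinite)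
    (hLB : SelmerRankLB) (hPG : PGSelmerBSD) (hTw : TwistRankLeOne) : _root_.BirchSwinnertonDyer := by
  -- D-0027 §2.1 deciding theorem of route VerticalContact (rev 4: items VerticalContact /
  -- VerticalSelmerBound restated, R1 quantifier repair + R2 weight clause): crux-only hypotheses (the six items) to the
  -- sub-problem Statement. UB in the multiplicative sector: VerticalContact + VerticalSelmerBound at depth
  -- N = C + C' give (N+1)·(corank E + corank E^{d_K}) ≤ 2m(N+1) + C + C', hence corank E + corank E^{d_K}
  -- ≤ 2m ≤ r_an(E) + r_an(E^{d_K}); TwistRankLeOne (r_an(E^{d_K}) ≤ 1) gives r_an(E^{d_K}) ≤ corank(E^{d_K});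
  -- so corank(E) ≤ r_an(E) at the contact prime p, and SelmerRankLB there gives equality. PG sector:
  -- PGSelmerBSD. Then Greenberg's identity, Ш[p^∞] finite ⇒ shaCorank = 0, transport of rank / Euler
  -- factors / analytic rank along a global minimal model (T1–T3, re-derived exactly as in route
  -- SelmerRank's / ToricShedding's certified closes), and selmerCorank_identity_imp_thesis_imp_bsd.
  have hUBmult : ∀ (V : WeierstrassCurve ℚ) [V.IsElliptic] [V.IsGloballyMinimal],
      (∃ (q : ℕ) (_ : Fact q.Prime), V.HasMultiplicativeReductionAtPrime q) →
      ∃ (p : ℕ) (_ : Fact p.Prime), 5 ≤ p ∧ V.HasGoodReductionAtPrime p ∧ ¬ (p : ℤ) ∣ V.frobeniusTrace p ∧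
        V.HasSurjectiveModNGaloisRep p ∧ V.selmerCorank p ≤ V.analyticRank := by
    intro V _ _ hm
    -- rev 4: the coefficient data (F, 𝔓, ι, e, e') now live under `∀ N` in VerticalContact, and
    -- VerticalSelmerBound's constant C' is uniform in them, so the diagonal depth N = C + C' is
    -- chosen first and the depth-N coefficient field is produced afterwards.
    obtain ⟨p, hp, K, hFK, hNK, Nplus, Nminus, a, b, O, ψ, I₁, a₀, α, m, C, hData, ⟨h2m, htw⟩, hN⟩ :=
      hC V hm
    obtain ⟨C', hC'⟩ := hB V p K Nplus Nminus a b O ψ I₁ a₀ α hData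
    obtain ⟨⟨h5, hgood, hord, hsurj, -, -⟩, -⟩ := hData
    refine ⟨p, hp, h5, hgood, hord, hsurj, ?_⟩
    obtain ⟨F, hFF, hNF, hA, 𝔓, ι, e, e', k, lam, Φ, hFdata, hForm, hBnd⟩ := hN (C + C')
    obtain ⟨I₀, hI₀, hpt, e₀, he₀, j, hQ, hj⟩ := hC' F 𝔓 ι e e' hFdata (C + C') k lam Φ hForm
    have hjle : j ≤ 2 * m * (C + C' + 1) + C := hBnd I₀ hI₀ hpt e₀ he₀ j hQ
    have hσle : V.selmerCorank p + (V.quadraticTwist (NumberField.discr K : ℚ)).selmerCorank p ≤ 2 * m := by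
      by_contra hcon
      have h1 : 2 * m + 1 ≤ V.selmerCorank p + (V.quadraticTwist (NumberField.discr K : ℚ)).selmerCorank p := by
        omega
      have h2 := Nat.mul_le_mul_left (C + C' + 1) h1
      nlinarith
    have hd : (NumberField.discr K : ℚ) ≠ 0 := by exact_mod_cast NumberField.discr_ne_zero K
    haveI := V.isElliptic_quadraticTwist hd
    have htw' := hTw (V.quadraticTwist (NumberField.discr K : ℚ)) p htw
    omega
  have hId : ∀ (W : WeierstrassCurve ℚ), W.selmerCorank_eq_mordellWeilRank_add :=
    fun W => W.selmerCorank_eq_mordellWeilRank_add_holds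
  have hZ : ∀ (W : WeierstrassCurve ℚ) [W.IsElliptic] (p : ℕ) [Fact p.Prime],
      Finite ↥(AddCommGroup.primaryComponent W.sha p) → W.shaCorank p = 0 :=
    Literature.BSD.shaCorank_eq_zero_of_finite
  -- (T1) the Mordell–Weil rank is an isomorphism invariant (AEC III.3.1(b); `VariableChangePoints`)
  have hMW : ∀ (W : WeierstrassCurve ℚ) (C : WeierstrassCurve.VariableChange ℚ),
      (C • W).mordellWeilRank = W.mordellWeilRank := fun W C =>
    @WeierstrassCurve.VariableChange.finrank_point_variableChange ℚ _ W C (Classical.decEq ℚ)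
  -- (T2) the local Euler factor is an isomorphism invariant (AEC VII.1.3(b), VII.2, VII.5.1, C §16)
  have hloc : ∀ (R : Type) [CommRing R] [IsDomain R] [IsDiscreteValuationRing R]
      (K : Type) [Field K] [Algebra R K] [IsFractionRing R K]
      (W : WeierstrassCurve K) [W.IsElliptic] (C : WeierstrassCurve.VariableChange K),
      (C • W).localEulerFactor R = W.localEulerFactor R := by
    intro R _ _ _ K _ _ _ W _ C
    obtain ⟨D, hD⟩ : ∃ D : WeierstrassCurve.VariableChange K,
        (C • W).minimal R = D • W.minimal R :=
      ⟨((C • W).exists_isMinimal R).choose * C * ((W.exists_isMinimal R).choose)⁻¹, by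
        rw [WeierstrassCurve.minimal, WeierstrassCurve.minimal, mul_smul, mul_smul, inv_smul_smul]⟩
    haveI hE : (W.minimal R).IsElliptic := by rw [WeierstrassCurve.minimal]; infer_instance
    have hΔ : (W.minimal R).Δ ≠ 0 := (W.minimal R).isUnit_Δ.ne_zero
    have hgood : ((C • W).minimal R).HasGoodReduction R ↔ (W.minimal R).HasGoodReduction R := by
      rw [WeierstrassCurve.hasGoodReduction_iff, WeierstrassCurve.hasGoodReduction_iff,
        WeierstrassCurve.valuation_Δ_eq_of_isMinimal_of_eq_smul R hD]
      exact and_congr_left' ⟨fun _ => inferInstance, fun _ => inferInstance⟩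
    have hcard : Nat.card (((C • W).minimal R).reduction R).toAffine.Point =
        Nat.card ((W.minimal R).reduction R).toAffine.Point := by
      obtain ⟨E, hE⟩ := WeierstrassCurve.exists_reduction_eq_smul R hD hΔ
      rw [hE]
      exact WeierstrassCurve.natCard_point_smul _ _
    have hpoly : (C • W).localPolynomial R = W.localPolynomial R := by
      classical
      unfold WeierstrassCurve.localPolynomial
      simp only [hgood, hcard,
        WeierstrassCurve.hasSplitMultiplicativeReduction_iff_of_isMinimal_of_eq_smul R hD hΔ,
        WeierstrassCurve.hasMultiplicativeReduction_iff_of_isMinimal_of_eq_smul R hD hΔ]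
    simp only [WeierstrassCurve.localEulerFactor, WeierstrassCurve.localPowerSeries, hpoly]
  -- (T3) hence the analytic rank is an isomorphism invariant (AEC App. C §16)
  have hAn : ∀ (W : WeierstrassCurve ℚ) [W.IsElliptic] (C : WeierstrassCurve.VariableChange ℚ),
      (C • W).analyticRank = W.analyticRank := by
    intro W _ C
    have hL : (C • W).LFunction = W.LFunction := by
      unfold WeierstrassCurve.LFunction
      congr 1
      funext v
      simp only [WeierstrassCurve.baseChange, ← WeierstrassCurve.map_variableChange]
      exact hloc _ _ _ _
    have hLS : (C • W).LSeries = W.LSeries := by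
      funext s
      simp only [WeierstrassCurve.LSeries, hL]
    have hEC : (C • W).entireContinuations = W.entireContinuations := by
      simp only [WeierstrassCurve.entireContinuations, hLS]
    have hEL : (C • W).entireLFunction = W.entireLFunction := by
      unfold WeierstrassCurve.entireLFunction
      rw [hEC, hLS]
    simp only [WeierstrassCurve.analyticRank, hEL]
  -- Selmer-rank BSD at ONE prime on a global minimal model, in two sectors
  have hmin : ∀ (V : WeierstrassCurve ℚ) [V.IsElliptic] [V.IsGloballyMinimal],
      ∃ (p : ℕ) (_ : Fact p.Prime), V.selmerCorank p = V.analyticRank := by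
    intro V _ _
    by_cases hm : ∃ (q : ℕ) (_ : Fact q.Prime), V.HasMultiplicativeReductionAtPrime q
    · -- a multiplicative prime: vertical contact order at the contact prime
      obtain ⟨p, hp, h5, hgood, hord, hsurj, hUB⟩ := hUBmult V hm
      exact ⟨p, hp, le_antisymm hUB (hLB V p h5 hgood hord hsurj)⟩
    · -- potentially good everywhere: the sector item
      exact hPG V hm
  -- transport to an arbitrary model and assemble
  refine Literature.BSD.selmerCorank_identity_imp_thesis_imp_bsd hId ?_
  intro W _
  obtain ⟨C, hC⟩ := WeierstrassCurve.hasGlobalMinimalModel_rat_holds W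
  obtain ⟨p, hp, hminp⟩ := hmin (C • W)
  refine ⟨p, hp.out, ?_, hZ W p (hSha W p)⟩
  have h1 : W.selmerCorank p = W.mordellWeilRank + W.shaCorank p := hId W p
  have h2 : (C • W).selmerCorank p = (C • W).mordellWeilRank + (C • W).shaCorank p := hId (C • W) p
  have h3 : W.shaCorank p = 0 := hZ W p (hSha W p)
  have h4 : (C • W).shaCorank p = 0 := hZ (C • W) p (hSha (C • W) p)
  have h6 := hMW W C
  have h7 := hAn W C
  omega

end Summit.BirchSwinnertonDyer.BirchSwinnertonDyer.Theses.VerticalContact
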